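import Summits.CriticalPhenomena.CardyFormulaZ2.Theses.CardyAnchoredRigidity
import Summits.CriticalPhenomena.CardyFormulaZ2.Theses.CardyLocalRigidity
import Summits.CriticalPhenomena.CardyFormulaZ2.Theorems.CardyAnchoredRigiditySubseqCardyRecurrentSublimit

/-!
# Line `recurrent` for crux `SubseqCardy` (stmt-CriticalPhenomena-5768) — Birkhoff selection on the
# dilation flow of the cluster set, then rigidity of recurrent sublimits

Crux (shared verbatim by routes `CardyAnchoredRigidity` / `CardyLocalRigidity`): along SOME mesh
sequence `u → 0⁺` the bond-`ℤ²` crossing probabilities of every conformal rectangle converge to Cardy's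
value — in the route's frame, the Cardy shadow lies in the cluster set `Λ' = clusterSet` of the
crossing-function path. Strategist line (crux-strategist s1, 2026-08-17), ALTERNATIVE to the lead's
registered line `birth` (stubs `stub_limitConformal` = X_M: EVERY joint sublimit is conformally
invariant; `stub_conformalLimitIsCardy` = SubseqRigidity): the `∃` over mesh sequences in the crux is
cashed by a SELECTION on the dilation flow `scaleAct` of `Λ'` (`Λ'` is compact, nonempty and
scale-invariant — all proved), namely Birkhoff's recurrence theorem, which produces a UNIFORMLY
RECURRENT joint sublimit for free (tree theorem `Recurrent.birkhoffSelection`,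
Theorems/CardyAnchoredRigiditySubseqCardyRecurrentSublimit.lean). What remains is rigidity of
RECURRENT sublimits only, cut along the dynamical dichotomy:

* `stub_recurrent_isFixed` — a uniformly recurrent point of the dilation flow on `Λ'` is a fixed
  point (no RG limit cycle / almost-periodic RG orbit in bond-`ℤ²` crossing data). Strictly weaker than
  `ScaleInvariantLimits` (stmt-10265) / `CardyRotToConfR3ScaleInvariance` (stmt-0699), which ask scale
  invariance of EVERY sublimit; here only the recurrent ones, which carry syndetic near-periods.
* `stub_fixed_conformal` — a scale-FIXED joint sublimit (hence similarity-invariant: translations and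
  `D₄` are proved for every cluster point, rotations under DKKMO) is conformally invariant: the
  crossing-level "Euclidean + scale ⇒ conformal" step for genuine percolation sublimits (subsequential
  twin of `SimilarityUpgrade`, stmt-4597; curve-level twins `SymmetryUpgradeR` stmt-17237/17239).
  Strictly weaker than X_M = `stub_limitConformal` (fixed points of `Λ'` only).
* `stub_subseqRigidity` — `SubseqRigidity` (stmt-CriticalPhenomena-8271 verbatim; ⟺ the lead's
  `stub_conformalLimitIsCardy` by the landed Reduction file): a conformally invariant sequential kernel
  is Cardy's `F`.

Composition (kernel-checked, no sorry outside the stubs): Birkhoff selection + the two symmetry stubs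
give the strategist's split child `ConformalSublimit` (`Recurrent.conformalSublimit_of_fixed_conformal`),
and the landed split glue `Split.subseqCardy_of_conformalSublimit_of_subseqRigidity` (p170423) adds
`SubseqRigidity` to reach the crux for BOTH route decls (`SubseqCardy_of`, `SubseqCardy_of_local`).
-/

namespace Summit.CriticalPhenomena.CardyFormulaZ2.Cruxes.SubseqCardy.Recurrent

/-- **Stub 1 (rank 2, the new content): recurrent ⇒ fixed.** Every uniformly recurrent point of the
dilation flow on the cluster set `Λ'` is scale-fixed. Why it might fail: an RG limit cycle (a closed
orbit of the flow inside `Λ'`, i.e. a log-periodic genuine sublimit) or an almost-periodic minimal set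
is excluded by no known argument for a non-unitary theory (DerridaGiacomin2013-type log-periodic
amplitudes in hierarchical models; abstractly such orbits exist: Disproof of stmt-10265,
`exists_rotationInvariant_lagTwo_not_lagThree`). Sources: SchrammSmirnov2011 §1.3;
GarbanPeteSchramm2013 §2.3; DKKMO2020Rotational §1.1; Furstenberg1981 Ch. 1 §4. -/
theorem stub_recurrent_isFixed : ∀ g ∈ Summit.CriticalPhenomena.CardyFormulaZ2.Theorems.CardyShadowIsolated.DilationDynamics.clusterSet, Literature.Dynamics.TopologicalDynamics.IsUniformlyRecurrentPt Summit.CriticalPhenomena.CardyFormulaZ2.Theorems.CardyShadowIsolated.DilationDynamics.scaleAct g → ∀ s : ℝ, Summit.CriticalPhenomena.CardyFormulaZ2.Theorems.CardyShadowIsolated.DilationDynamics.scaleAct s g = g := by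
  sorry

/-- **Stub 2 (rank 3): scale-fixed ⇒ conformal.** A scale-fixed joint cluster point of the bond-`ℤ²`
crossing-function path is a function of the conformal modulus. Why it might fail: no rigorous
"Euclidean + scale ⇒ conformal" principle at `c = 0` (barrier `ScaleCovarianceNotMoebius`; the
abstract curve-family form is refuted, `not_SymmetryUpgrade`, stmt-0698); the proof must use
percolation structure beyond symmetry (locality / domain Markov of the interface sublimit, DKKMO
rotation invariance) — cf. stmt-4597, stmt-17239. Sources: Schramm2000 §1.5; LawlerSchrammWerner2001
§3; DKKMO2020Rotational Thm 1.4; CamiaNewman2007; RivaCardy2005. -/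
theorem stub_fixed_conformal : ∀ g ∈ Summit.CriticalPhenomena.CardyFormulaZ2.Theorems.CardyShadowIsolated.DilationDynamics.clusterSet, (∀ s : ℝ, Summit.CriticalPhenomena.CardyFormulaZ2.Theorems.CardyShadowIsolated.DilationDynamics.scaleAct s g = g) → ∃ G : ℝ → ℝ, ∀ (R : Literature.Probability.RandomPlanarGeometry.ConformalRectangle) (ψ : Literature.Probability.RandomPlanarGeometry.ConformalEquiv UpperHalfPlane.upperHalfPlaneSet R.carrier) (x : Fin 4 → ℝ), R.IsUniformizing ψ x → g R = G (Literature.Probability.RandomPlanarGeometry.crossRatio x) := by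
  sorry

/-- **Stub 3 (rank 4): `SubseqRigidity`** (stmt-CriticalPhenomena-8271 verbatim). Sources:
CamiaNewman2007 Thm 3, Rem 5.4; Smirnov2001; Schramm2000; LawlerSchrammWerner2001;
KemppainenSmirnov2017. -/
theorem stub_subseqRigidity : ∀ u : ℕ → ℝ, Filter.Tendsto u Filter.atTop (nhdsWithin (0 : ℝ) (Set.Ioi 0)) → ∀ g : ℝ → ℝ, (∀ (R : Literature.Probability.RandomPlanarGeometry.ConformalRectangle) (ψ : Literature.Probability.RandomPlanarGeometry.ConformalEquiv UpperHalfPlane.upperHalfPlaneSet R.carrier) (x : Fin 4 → ℝ), R.IsUniformizing ψ x → Filter.Tendsto (fun n => Literature.Probability.Percolation.bondDomainCrossingProb R (u n)) Filter.atTop (nhds (g (Literature.Probability.RandomPlanarGeometry.crossRatio x)))) → Set.EqOn g Literature.Probability.RandomPlanarGeometry.cardyFunction (Set.Ioo 0 1) := by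
  sorry

/-! ### Name-keyed aliases of the three open statements (audit matches hypotheses by stub name) -/
namespace Registered

/-- Statement of `stub_recurrent_isFixed`, keyed by the registered stub name. -/
abbrev stub_recurrent_isFixed : Prop :=
  ∀ g ∈ Summit.CriticalPhenomena.CardyFormulaZ2.Theorems.CardyShadowIsolated.DilationDynamics.clusterSet, Literature.Dynamics.TopologicalDynamics.IsUniformlyRecurrentPt Summit.CriticalPhenomena.CardyFormulaZ2.Theorems.CardyShadowIsolated.DilationDynamics.scaleAct g → ∀ s : ℝ, Summit.CriticalPhenomena.CardyFormulaZ2.Theorems.CardyShadowIsolated.DilationDynamics.scaleAct s g = g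

/-- Statement of `stub_fixed_conformal`, keyed by the registered stub name. -/
abbrev stub_fixed_conformal : Prop :=
  ∀ g ∈ Summit.CriticalPhenomena.CardyFormulaZ2.Theorems.CardyShadowIsolated.DilationDynamics.clusterSet, (∀ s : ℝ, Summit.CriticalPhenomena.CardyFormulaZ2.Theorems.CardyShadowIsolated.DilationDynamics.scaleAct s g = g) → ∃ G : ℝ → ℝ, ∀ (R : Literature.Probability.RandomPlanarGeometry.ConformalRectangle) (ψ : Literature.Probability.RandomPlanarGeometry.ConformalEquiv UpperHalfPlane.upperHalfPlaneSet R.carrier) (x : Fin 4 → ℝ), R.IsUniformizing ψ x → g R = G (Literature.Probability.RandomPlanarGeometry.crossRatio x)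

/-- Statement of `stub_subseqRigidity` (= `CardyMirrorMonotone.SubseqRigidity`, stmt-8271, verbatim),
keyed by the registered stub name. -/
abbrev stub_subseqRigidity : Prop :=
  ∀ u : ℕ → ℝ, Filter.Tendsto u Filter.atTop (nhdsWithin (0 : ℝ) (Set.Ioi 0)) → ∀ g : ℝ → ℝ, (∀ (R : Literature.Probability.RandomPlanarGeometry.ConformalRectangle) (ψ : Literature.Probability.RandomPlanarGeometry.ConformalEquiv UpperHalfPlane.upperHalfPlaneSet R.carrier) (x : Fin 4 → ℝ), R.IsUniformizing ψ x → Filter.Tendsto (fun n => Literature.Probability.Percolation.bondDomainCrossingProb R (u n)) Filter.atTop (nhds (g (Literature.Probability.RandomPlanarGeometry.crossRatio x)))) → Set.EqOn g Literature.Probability.RandomPlanarGeometry.cardyFunction (Set.Ioo 0 1)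

end Registered

/-! ### The composition: the three stubs imply the crux, by name (Birkhoff selection discharged) -/

/-- **The line concludes the crux** (route `CardyAnchoredRigidity` decl): Birkhoff selection
(`birkhoffSelection`, proved) + stub 1 + stub 2 ⇒ the split child `ConformalSublimit`
(`conformalSublimit_of_fixed_conformal`); + stub 3 ⇒ `SubseqCardy` by the landed split glue
`Split.subseqCardy_of_conformalSublimit_of_subseqRigidity` (p170423). Pure logic, no `sorry`. -/
theorem SubseqCardy_of (h₁ : Registered.stub_recurrent_isFixed) (h₂ : Registered.stub_fixed_conformal)
    (h₃ : Registered.stub_subseqRigidity) :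
    Summit.CriticalPhenomena.CardyFormulaZ2.Theses.CardyAnchoredRigidity.SubseqCardy :=
  Summit.CriticalPhenomena.CardyFormulaZ2.Cruxes.SubseqCardy.Split.subseqCardy_of_conformalSublimit_of_subseqRigidity
    (conformalSublimit_of_fixed_conformal h₁ h₂) h₃

/-- **The shared copy** (route `CardyLocalRigidity`, same item, same body — definitional unfolding). -/
theorem SubseqCardy_of_local (h₁ : Registered.stub_recurrent_isFixed) (h₂ : Registered.stub_fixed_conformal)
    (h₃ : Registered.stub_subseqRigidity) :
    Summit.CriticalPhenomena.CardyFormulaZ2.Theses.CardyLocalRigidity.SubseqCardy :=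
  SubseqCardy_of h₁ h₂ h₃

end Summit.CriticalPhenomena.CardyFormulaZ2.Cruxes.SubseqCardy.Recurrent
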